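import Literature.Probability.LatticeModels.BoxDirichlet
import HarnessLib

/-!
# Sharp small-angle asymptotics of the box mode rate: `θ(1 - 7θ²/16) ≤ μ(θ) ≤ θ` and `N μ(πk/N) → πk`

Topic `Literature/Probability/LatticeModels`; continuation of `BoxDirichlet.lean`, whose mode rate
`μ(θ) = modeRate θ = arcosh(2 - cos θ)` (the vertical decay rate of the lattice-harmonic separable
function `sin(θx) sinh(μ(θ)y)`) was only compared to `θ` up to constants
(`modeRateConst · |θ| ≤ μ(θ) ≤ |θ|`). For the convergence of the lattice box Poisson kernel to the
continuum one (the box-geometry form of Lawler–Schramm–Werner's "continuous harmonic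
approximation", Ann. Probab. 32 (2004), Lemma 5.3: in the scaling `θ = πk/N` the `k`-th lattice mode
`sin(πk x) sinh(N μ(πk/N) y)/sinh(N μ(πk/N))` must tend to the continuum mode
`sin(πk x) sinh(πk y)/sinh(πk)`) one needs `μ(θ)/θ → 1` with a rate. Everything here is proved from
the hyperbolic/trigonometric inequalities of `BoxDirichlet.lean` and Mathlib's `Real.cos_bound`:

* `cosh_sq_le_one_add` — `cosh² y ≤ 1 + (4/3) y²` for `0 ≤ y ≤ 1/2` (`sinh y ≤ y cosh y`);
* **`modeRate_ge_cubic`** — `θ (1 - 7θ²/16) ≤ μ(θ)` for `0 ≤ θ ≤ 1` (with `μ(θ) ≤ θ`: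
  `|μ(θ) - θ| ≤ (7/16) θ³`, `abs_modeRate_sub_le`);
* **`abs_mul_modeRate_sub_le`** — `|N μ(πk/N) - πk| ≤ (7/16)(πk)³/N²` for `N ≥ πk`, and
  `tendsto_mul_modeRate` — `N μ(πk/N) → πk` as `N → ∞`.

## References

* G. F. Lawler, O. Schramm, W. Werner, Ann. Probab. 32 (2004) 939–995, Lemma 5.3 [LawlerSchrammWerner2004].
* R. Courant, K. Friedrichs, H. Lewy, Math. Ann. 100 (1928) 32–74, §2–§4 (convergence of the
  difference scheme) [folklore].
-/

noncomputable section

namespace Literature.Probability.LatticeModels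

open Real Filter
open scoped Topology

/-- `cosh² y ≤ 1 + (4/3) y²` for `0 ≤ y ≤ 1/2` (`cosh² = 1 + sinh²` and `sinh y ≤ y cosh y` give
`sinh² y (1 - y²) ≤ y²`). [folklore] -/
theorem cosh_sq_le_one_add {y : ℝ} (hy0 : 0 ≤ y) (hy : y ≤ 1 / 2) : cosh y ^ 2 ≤ 1 + 4 / 3 * y ^ 2 := by
  have h1 : cosh y ^ 2 = 1 + sinh y ^ 2 := by nlinarith [Real.cosh_sq y]
  have h2 : sinh y ≤ y * cosh y := sinh_le_mul_cosh hy0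
  have h3 : 0 ≤ sinh y := Real.sinh_nonneg_iff.2 hy0
  have hc0 : 0 ≤ cosh y := (Real.cosh_pos y).le
  have h7 : sinh y ^ 2 ≤ y ^ 2 * cosh y ^ 2 := by
    have := mul_le_mul h2 h2 h3 (by positivity)
    nlinarith
  have h8 : sinh y ^ 2 ≤ y ^ 2 * (1 + sinh y ^ 2) := by rw [← h1]; exact h7
  have hy2 : y ^ 2 ≤ 1 / 4 := by nlinarith
  have h9 : y ^ 2 * sinh y ^ 2 ≤ 1 / 4 * sinh y ^ 2 := mul_le_mul_of_nonneg_right hy2 (sq_nonneg _)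
  nlinarith

/-- **Sharp lower bound of the mode rate**: `θ (1 - 7θ²/16) ≤ μ(θ)` for `0 ≤ θ ≤ 1`. Proof:
`θ²/2 - (5/96)θ⁴ ≤ 1 - cos θ = cosh μ - 1 ≤ (μ²/2) cosh²(μ/2) ≤ (μ²/2)(1 + θ²/3)` (`μ ≤ θ`), whence
`μ² ≥ θ²(1 - (5/48)θ²)(1 - θ²/3) ≥ θ² (1 - (7/16)θ²)`, and `√(1 - a) ≥ 1 - a`.
[cite: LawlerSchrammWerner2004, Lemma 5.3] -/
theorem modeRate_ge_cubic {θ : ℝ} (hθ0 : 0 ≤ θ) (hθ1 : θ ≤ 1) :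
    θ * (1 - 7 / 16 * θ ^ 2) ≤ modeRate θ := by
  set μ := modeRate θ with hμ
  have hμ0 : 0 ≤ μ := modeRate_nonneg θ
  have hμθ : μ ≤ θ := by simpa [abs_of_nonneg hθ0] using modeRate_le_abs θ
  -- `1 - cos θ ≥ θ²/2 - (5/96) θ⁴`
  have hcos : 1 - cos θ ≥ θ ^ 2 / 2 - 5 / 96 * θ ^ 4 := by
    have hb := Real.cos_bound (show |θ| ≤ 1 by rwa [abs_of_nonneg hθ0])
    rw [abs_of_nonneg hθ0] at hb
    have := (abs_le.1 hb).2
    linarith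
  -- `cosh μ - 1 ≤ (μ²/2)(1 + θ²/3)`
  have hup : cosh μ - 1 ≤ μ ^ 2 / 2 * (1 + θ ^ 2 / 3) := by
    have h1 := cosh_sub_one_le_sq_mul_cosh_sq μ hμ0
    have h2 : cosh (μ / 2) ^ 2 ≤ 1 + 4 / 3 * (μ / 2) ^ 2 := cosh_sq_le_one_add (by linarith) (by linarith)
    have h3 : 1 + 4 / 3 * (μ / 2) ^ 2 ≤ 1 + θ ^ 2 / 3 := by nlinarith
    calc cosh μ - 1 ≤ μ ^ 2 / 2 * cosh (μ / 2) ^ 2 := h1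
      _ ≤ μ ^ 2 / 2 * (1 + θ ^ 2 / 3) := by gcongr; exact h2.trans h3
  rw [cosh_modeRate] at hup
  -- combine: `μ² (1 + θ²/3) ≥ θ² - (5/48) θ⁴` and `μ² θ² ≤ θ⁴`, hence `μ² ≥ θ² (1 - 7θ²/16)`
  have hμ2 : μ ^ 2 ≤ θ ^ 2 := pow_le_pow_left₀ hμ0 hμθ 2
  have hprod : μ ^ 2 * θ ^ 2 ≤ θ ^ 2 * θ ^ 2 := mul_le_mul_of_nonneg_right hμ2 (sq_nonneg θ)
  have hsq : θ ^ 2 * (1 - 7 / 16 * θ ^ 2) ≤ μ ^ 2 := by nlinarith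
  -- take square roots: `(θ(1 - a))² = θ²(1 - a)² ≤ θ²(1 - a) ≤ μ²` for `a = 7θ²/16 ∈ [0, 1]`
  set a : ℝ := 7 / 16 * θ ^ 2 with ha_def
  have ha0 : 0 ≤ 1 - a := by rw [ha_def]; nlinarith
  have ha1 : 1 - a ≤ 1 := by rw [ha_def]; nlinarith
  have h1a : (1 - a) ^ 2 ≤ (1 - a) := by nlinarith
  have hle : (θ * (1 - a)) ^ 2 ≤ μ ^ 2 := by
    calc (θ * (1 - a)) ^ 2 = θ ^ 2 * (1 - a) ^ 2 := by ring
      _ ≤ θ ^ 2 * (1 - a) := mul_le_mul_of_nonneg_left h1a (sq_nonneg θ)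
      _ ≤ μ ^ 2 := hsq
  exact (pow_le_pow_iff_left₀ (mul_nonneg hθ0 ha0) hμ0 two_ne_zero).1 hle

/-- `|μ(θ) - θ| ≤ (7/16) θ³` for `0 ≤ θ ≤ 1`. [cite: LawlerSchrammWerner2004, Lemma 5.3] -/
theorem abs_modeRate_sub_le {θ : ℝ} (hθ0 : 0 ≤ θ) (hθ1 : θ ≤ 1) : |modeRate θ - θ| ≤ 7 / 16 * θ ^ 3 := by
  have h1 := modeRate_ge_cubic hθ0 hθ1
  have h2 : modeRate θ ≤ θ := by simpa [abs_of_nonneg hθ0] using modeRate_le_abs θ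
  rw [abs_le]
  constructor <;> nlinarith

/-- **`|N μ(πk/N) - πk| ≤ (7/16)(πk)³/N²`** for `N ≥ πk > 0`: the rescaled rate of the `k`-th mode of
a box of `N` sites is within `O(N⁻²)` of `πk`. [cite: LawlerSchrammWerner2004, Lemma 5.3] -/
theorem abs_mul_modeRate_sub_le {N : ℕ} {k : ℕ} (hN : π * k ≤ N) (hNpos : 0 < N) :
    |(N : ℝ) * modeRate (boxFreq N k) - π * k| ≤ 7 / 16 * (π * k) ^ 3 / (N : ℝ) ^ 2 := by
  have hNr : (0 : ℝ) < N := by exact_mod_cast hNpos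
  have hθ0 : 0 ≤ boxFreq N k := boxFreq_nonneg N k
  have hθ1 : boxFreq N k ≤ 1 := by
    unfold boxFreq
    rw [div_le_one hNr]
    exact hN
  have h := abs_modeRate_sub_le hθ0 hθ1
  have hθ : boxFreq N k = π * k / N := rfl
  have key : (N : ℝ) * modeRate (boxFreq N k) - π * k = N * (modeRate (boxFreq N k) - boxFreq N k) := by
    rw [hθ]; field_simp
  rw [key, abs_mul, abs_of_pos hNr]
  calc (N : ℝ) * |modeRate (boxFreq N k) - boxFreq N k| ≤ N * (7 / 16 * boxFreq N k ^ 3) := by gcongr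
    _ = 7 / 16 * (π * k) ^ 3 / (N : ℝ) ^ 2 := by rw [hθ]; field_simp

/-- **`N μ(πk/N) → πk`** as `N → ∞`, for every fixed `k`. [cite: LawlerSchrammWerner2004, Lemma 5.3] -/
theorem tendsto_mul_modeRate (k : ℕ) :
    Tendsto (fun N : ℕ => (N : ℝ) * modeRate (boxFreq N k)) atTop (𝓝 (π * k)) := by
  have hbound : ∀ᶠ N : ℕ in atTop, |(N : ℝ) * modeRate (boxFreq N k) - π * k| ≤ 7 / 16 * (π * k) ^ 3 / (N : ℝ) ^ 2 := by
    filter_upwards [eventually_ge_atTop (⌈π * k⌉₊ + 1)] with N hN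
    have hN1 : 0 < N := by omega
    have hNk : π * k ≤ N := by
      have : (⌈π * k⌉₊ : ℝ) + 1 ≤ N := by exact_mod_cast hN
      linarith [Nat.le_ceil (π * (k : ℝ))]
    exact abs_mul_modeRate_sub_le hNk hN1
  have hzero : Tendsto (fun N : ℕ => 7 / 16 * (π * k) ^ 3 / (N : ℝ) ^ 2) atTop (𝓝 0) := by
    have h1 : Tendsto (fun N : ℕ => ((N : ℝ) ^ 2)⁻¹) atTop (𝓝 0) := by
      have := (tendsto_pow_atTop (α := ℝ) (n := 2) two_ne_zero).comp tendsto_natCast_atTop_atTop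
      exact this.inv_tendsto_atTop
    have h2 := h1.const_mul (7 / 16 * (π * k) ^ 3)
    simpa [div_eq_mul_inv] using h2
  rw [tendsto_iff_norm_sub_tendsto_zero]
  refine squeeze_zero_norm' ?_ hzero
  filter_upwards [hbound] with N hN
  simpa [Real.norm_eq_abs] using hN

end Literature.Probability.LatticeModels
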